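import Summits.HodgeConjecture.Ring2.CMFivefoldsCodimTwo
import Literature.AlgebraicGeometry.ComplexMultiplication.SimpleFourfoldImaginaryCentre
import Literature.AlgebraicGeometry.HodgeTheory.SimpleThreefoldCMEmbeddingCaseF
import HarnessLib

/-!
# Ring 2 (cell topic `Summits/HodgeConjecture/Ring2/`; seat `lit`, gen 64, R39): the residual of the fivefold fact `MoonenZarhin1999_codimTwoHodgeClasses_abelianFivefold` in ALBERT'S TERMS — case (e) with `End⁰(T) = k`, case (g) with `End⁰(F) ⊋ k` a quartic field or a quaternion algebra over `k`

HONEST FRAMING (cell `pub-hodge-ring2`, verbatim): research route conditional on HC_CM; not a corollary;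
Q11.4-sentence-2 already refuted in dim ≥ 3. `HC_CM` does NOT occur in this file, nor does Markman's theorem;
everything is UNCONDITIONAL (Tankeev–Ribet is a HYPOTHESIS of one theorem). Theorems only — no definition, no named
fact, no `sorry`. No case of the Hodge conjecture is claimed.

THE PRINT. B. Moonen, Yu. Zarhin, Math. Ann. **315** (1999), Thm. 0.2 cases (e) «`X ∼ X₁² × X₂`, `X₁, X₂` as in (a)»
(so `k = End⁰(X₁) ↪ End⁰(X₂)`, `X₂` a simple threefold: `End⁰(X₂) = k` (a1) or a sextic CM field `⊇ k` (a2)) and (g)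
«`X₂` a simple abelian fourfold such that there exists an embedding `k ↪ End⁰(X₂)` via which `k` acts on `T_{X₂,0}`
with multiplicities `(1,3)`»; §2 (2.4) (simple threefolds: Types I(1), I(3), IV(1,1), IV(3,1)) and the `g = 4`
paragraph; D. Mumford, *Abelian Varieties*, §21 (Albert's table: `e d² ∣ 2g`).

THIS FILE sharpens the companion localisation `CMFivefoldsCodimTwo.moonenZarhin1999_codimTwoHodgeClasses_abelianFivefold_iff_residual_not_isOfCMType`
(the fivefold fact ↔ its instances at NON-CM fivefolds in three classes) by reading the two non-CM residual classes
in Albert's table: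
* §1 `finrank_endAlgebra_eq_two_of_caseE` — in case (e), `T` NOT of CM type forces `dim_ℚ End⁰(T) = 2`, i.e.
  `End⁰(T) = k` (case (a1); the tree's `finrank_endAlgebra_eq_two_or_isOfCMType_of_dim_eq_three_of_ringHom`).
* §2 **`moonenZarhin1999_codimTwoHodgeClasses_abelianFivefold_iff_residual_albert`** — the fivefold fact ↔ its
  instances at (α) the SIMPLE fivefolds NOT of CM type [Tankeev–Ribet]; (β) case (e) ∩ (a1): `X ∼ E × (E × T)`, `E` a
  CM elliptic curve, `T` a simple threefold with `dim_ℚ End⁰(T) = 2` and `End⁰(E) ↪ End⁰(T)` [Thm. 0.2 (1)]; (γ) case (g)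
  with `X ∼ F × C`, `C` a CM elliptic curve (`χ ≫ χ = -d'`), `F` a simple fourfold NOT of CM type carrying a CENTRAL
  `φ`, `φ ≫ φ = -(M²d')`, of unbalanced multiplicities, and `End⁰(F)` EITHER a quartic FIELD (Type IV(2,1) `⊋ k`) OR of
  degree `8` with centre of degree `2` (a quaternion algebra over `k`) [Thm. 0.2 (3) with `End⁰(X₂) ⊋ k`] — by the
  Literature lane's `isField_or_finrank_eq_eight_of_dim_eq_four_of_not_isOfCMType_of_hom` (Albert at `g = 4`);
  `…_of_tankeevRibet`: granted Tankeev–Ribet, ↔ (β) ∧ (γ).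

WHAT IS NOT CLAIMED: the fact is NOT discharged; (β) and (γ) are exactly the non-CM rows of Thm. 0.2 (1) and (3) the
tree has not proved (the quaternion-over-`k` cell of (γ) is not excluded here: that `k` central with multiplicities
`(1,3)` is incompatible with `d = 2` is a representation-theoretic remark the tree does not have); nothing on `B² ≠ D²`.

## References
* [MoonenZarhin1999LowDim] B. Moonen, Yu. Zarhin, Math. Ann. 315 (1999) 711–733, Thm. 0.2 (1), (3), cases (e), (g),
  §2 (2.4) and the `g = 4` paragraph, §5 (5.11)–(5.12).
* [MumfordAV1970] D. Mumford, *Abelian Varieties* (1970), §19 Cor. 2, §21 (pp. 201–202).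
* [SilvermanAEC2009] J. H. Silverman, GTM 106 (2009), III.9 Cor. 9.4.
* [Ribet1983] K. A. Ribet, Amer. J. Math. 105 (1983) (with Tankeev: simple abelian varieties of prime dimension).
-/

noncomputable section

open CategoryTheory CategoryTheory.Limits

namespace Summit.HodgeConjecture.Ring2.NonCMFivefoldsCodimTwoResidual

open Literature.AlgebraicGeometry.Motives (AbelianVariety)
open Literature.AlgebraicGeometry.Motives.AbelianVariety
open Literature.AlgebraicGeometry.HodgeTheory
open Literature.AlgebraicGeometry.ComplexMultiplication
  (isField_or_finrank_eq_eight_of_dim_eq_four_of_not_isOfCMType_of_hom)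
open Literature.AlgebraicGeometry.Milne1999 (IsOfCMType)
open Summit.HodgeConjecture.Ring2.CMFivefoldsCodimTwo

variable {X : AbelianVariety ℂ}

/-! ### §1 Case (e) with `T` not of CM type is case (e) ∩ (a1): `End⁰(T) = k` -/

/-- **In case (e), `T` NOT of CM type means `dim_ℚ End⁰(T) = 2`** (`End⁰(E) = k ↪ End⁰(T)`, `T` a simple threefold:
`End⁰(T)` is `k` or a sextic CM field `⊇ k`, the latter being CM type — Moonen–Zarhin (2.4), the tree's
`finrank_endAlgebra_eq_two_or_isOfCMType_of_dim_eq_three_of_ringHom`; the complex multiplication `χ` of `E` from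
`EllipticCurve.isOfCMType_iff_exists_mul_self_eq_neg`). [cite: MoonenZarhin1999LowDim, §2 (2.4) and §5 (5.3)]
[cite: SilvermanAEC2009, III.9 Cor. 9.4] -/
theorem finrank_endAlgebra_eq_two_of_caseE {E T : AbelianVariety ℂ} (hE1 : E.dim = 1) (hEcm : IsOfCMType E)
    (hTs : T.IsSimple) (hT3 : T.dim = 3) (hT : ¬ IsOfCMType T) (j : E.endAlgebra →+* T.endAlgebra) :
    Module.finrank ℚ T.endAlgebra = 2 := by
  obtain ⟨χ, d, hd, hχ⟩ :=
    (Literature.NumberTheory.ComplexMultiplication.EllipticCurve.isOfCMType_iff_exists_mul_self_eq_neg hE1).1 hEcm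
  have hχ' : χ ≫ χ = -(d • 𝟙 E) := by
    rw [← CategoryTheory.End.mul_def, hχ, ← nsmul_one d]
    rfl
  exact (finrank_endAlgebra_eq_two_or_isOfCMType_of_dim_eq_three_of_ringHom hTs hT3 hd hχ' j).resolve_right hT

/-! ### §2 The residual in Albert's terms -/

/-- **LOCALISATION OF THE NAMED FACT IN ALBERT'S TERMS.** `MoonenZarhin1999_codimTwoHodgeClasses_abelianFivefold` is
EQUIVALENT to its instances at: (α) the SIMPLE fivefolds NOT of CM type [Tankeev–Ribet]; (β) case (e) ∩ (a1) —
`X ∼ E × (E × T)`, `E` a CM elliptic curve, `T` a simple threefold NOT of CM type with `dim_ℚ End⁰(T) = 2` (`= k`) and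
`End⁰(E) ↪ End⁰(T)` [Thm. 0.2 (1)]; (γ) case (g) with `End⁰(F) ⊋ k` — `X ∼ F × C`, `C` an elliptic curve with
`χ ≫ χ = -d'`, `F` a simple fourfold NOT of CM type with `End⁰(F)` a quartic FIELD or `[End⁰(F):ℚ] = 8` with centre of
degree `2`, a CENTRAL `φ` on `F` with `φ ≫ φ = -(M²d')` of unbalanced multiplicities, `dim_ℚ End⁰(F) ≠ 2` [Thm. 0.2 (3)].
[cite: MoonenZarhin1999LowDim, Thm. 0.2 (1)–(4), §2 (2.4) and §5 (5.1), (5.11)] [cite: MumfordAV1970, §21 (pp. 201–202)] -/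
theorem moonenZarhin1999_codimTwoHodgeClasses_abelianFivefold_iff_residual_albert :
    MoonenZarhin1999_codimTwoHodgeClasses_abelianFivefold ↔
      (∀ A : AbelianVariety ℂ, A.dim = 5 → A.IsSimple → ¬ IsOfCMType A → IsCodimTwoDivisorPullbackGenerated A) ∧
      (∀ A : AbelianVariety ℂ, A.dim = 5 →
        (∃ E T : AbelianVariety ℂ, E.dim = 1 ∧ IsOfCMType E ∧ T.IsSimple ∧ T.dim = 3 ∧
          Module.finrank ℚ T.endAlgebra = 2 ∧ ¬ IsOfCMType T ∧
          Nonempty (E.endAlgebra →+* T.endAlgebra) ∧ AbelianVariety.IsIsogenous A (E.prod (E.prod T))) →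
        IsCodimTwoDivisorPullbackGenerated A) ∧
      (∀ A : AbelianVariety ℂ, A.dim = 5 →
        (∃ (F C : AbelianVariety ℂ), F.IsSimple ∧ F.dim = 4 ∧ ¬ IsOfCMType F ∧
          ((IsField F.endAlgebra ∧ Module.finrank ℚ F.endAlgebra = 4) ∨
            (Module.finrank ℚ F.endAlgebra = 8 ∧ Module.finrank ℚ (Subalgebra.center ℚ F.endAlgebra) = 2)) ∧
          C.dim = 1 ∧ AbelianVariety.IsIsogenous A (F.prod C) ∧
          ∃ (χ : C ⟶ C) (d' : ℕ), 0 < d' ∧ χ ≫ χ = -(d' • 𝟙 C) ∧ ∃ (φ : F ⟶ F) (M : ℕ), 0 < M ∧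
          φ ≫ φ = -((M * M * d') • 𝟙 F) ∧ AbelianVariety.endAlgebra.of F φ ∈ Subalgebra.center ℚ F.endAlgebra ∧
          eigenMultiplicity F φ (Complex.I * (Real.sqrt (M * M * d' : ℕ) : ℂ)) ≠
            eigenMultiplicity F φ (-(Complex.I * (Real.sqrt (M * M * d' : ℕ) : ℂ))) ∧
          Module.finrank ℚ F.endAlgebra ≠ 2) →
        IsCodimTwoDivisorPullbackGenerated A) := by
  rw [moonenZarhin1999_codimTwoHodgeClasses_abelianFivefold_iff_residual_not_isOfCMType]
  refine ⟨fun ⟨hS, hE, hG⟩ => ⟨hS, fun A hA ⟨E, T, hE1, hEcm, hTs, hT3, _, hT, hj, hAET⟩ =>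
      hE A hA ⟨E, T, hE1, hEcm, hTs, hT3, hT, hj, hAET⟩, fun A hA ⟨F, C, hFs, hF4, hF, _, hrest⟩ =>
      hG A hA ⟨F, C, hFs, hF4, hF, hrest⟩⟩, fun ⟨hS, hE, hG⟩ => ⟨hS, ?_, ?_⟩⟩
  · rintro A hA ⟨E, T, hE1, hEcm, hTs, hT3, hT, ⟨j⟩, hAET⟩
    exact hE A hA ⟨E, T, hE1, hEcm, hTs, hT3, finrank_endAlgebra_eq_two_of_caseE hE1 hEcm hTs hT3 hT j, hT, ⟨j⟩,
      hAET⟩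
  · rintro A hA ⟨F, C, hFs, hF4, hF, hC, hAFC, χ, d', hd', hχ, φ, M, hM, hφ, hφZ, hneq, h2⟩
    exact hG A hA ⟨F, C, hFs, hF4, hF,
      isField_or_finrank_eq_eight_of_dim_eq_four_of_not_isOfCMType_of_hom hFs hF4 hF φ
        (Nat.mul_pos (Nat.mul_pos hM hM) hd') hφ hφZ h2,
      hC, hAFC, χ, d', hd', hχ, φ, M, hM, hφ, hφZ, hneq, h2⟩

/-- **GRANTED THE TANKEEV–RIBET FACT** (HYPOTHESIS `TankeevRibet1983_hodgeClasses_divisorial_powers_simplePrimeDimension`),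
the fivefold fact is EQUIVALENT to its instances at case (e) ∩ (a1) and at case (g) with `End⁰(F) ⊋ k` a quartic field
or a quaternion algebra over `k`, `F` not of CM type. [cite: MoonenZarhin1999LowDim, Thm. 0.2 (1), (3) and §2 Thm. (2.7)]
[cite: Ribet1983, Thm. 3] -/
theorem moonenZarhin1999_codimTwoHodgeClasses_abelianFivefold_iff_residual_albert_of_tankeevRibet
    (hTR : TankeevRibet1983_hodgeClasses_divisorial_powers_simplePrimeDimension) :
    MoonenZarhin1999_codimTwoHodgeClasses_abelianFivefold ↔
      (∀ A : AbelianVariety ℂ, A.dim = 5 →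
        (∃ E T : AbelianVariety ℂ, E.dim = 1 ∧ IsOfCMType E ∧ T.IsSimple ∧ T.dim = 3 ∧
          Module.finrank ℚ T.endAlgebra = 2 ∧ ¬ IsOfCMType T ∧
          Nonempty (E.endAlgebra →+* T.endAlgebra) ∧ AbelianVariety.IsIsogenous A (E.prod (E.prod T))) →
        IsCodimTwoDivisorPullbackGenerated A) ∧
      (∀ A : AbelianVariety ℂ, A.dim = 5 →
        (∃ (F C : AbelianVariety ℂ), F.IsSimple ∧ F.dim = 4 ∧ ¬ IsOfCMType F ∧
          ((IsField F.endAlgebra ∧ Module.finrank ℚ F.endAlgebra = 4) ∨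
            (Module.finrank ℚ F.endAlgebra = 8 ∧ Module.finrank ℚ (Subalgebra.center ℚ F.endAlgebra) = 2)) ∧
          C.dim = 1 ∧ AbelianVariety.IsIsogenous A (F.prod C) ∧
          ∃ (χ : C ⟶ C) (d' : ℕ), 0 < d' ∧ χ ≫ χ = -(d' • 𝟙 C) ∧ ∃ (φ : F ⟶ F) (M : ℕ), 0 < M ∧
          φ ≫ φ = -((M * M * d') • 𝟙 F) ∧ AbelianVariety.endAlgebra.of F φ ∈ Subalgebra.center ℚ F.endAlgebra ∧
          eigenMultiplicity F φ (Complex.I * (Real.sqrt (M * M * d' : ℕ) : ℂ)) ≠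
            eigenMultiplicity F φ (-(Complex.I * (Real.sqrt (M * M * d' : ℕ) : ℂ))) ∧
          Module.finrank ℚ F.endAlgebra ≠ 2) →
        IsCodimTwoDivisorPullbackGenerated A) := by
  rw [moonenZarhin1999_codimTwoHodgeClasses_abelianFivefold_iff_residual_albert]
  refine ⟨fun h => ⟨h.2.1, h.2.2⟩, fun h => ⟨fun A hA hs _ => ?_, h.1, h.2⟩⟩
  exact (isDivisorGenerated_powSucc_of_tankeevRibet hTR A (by norm_num : (5 : ℕ).Prime) hA hs 0)
    |>.isCodimTwoDivisorPullbackGenerated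

end Summit.HodgeConjecture.Ring2.NonCMFivefoldsCodimTwoResidual

end
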